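import Literature.Analysis.FluidPDE.PeriodicCylinderSobolevInequalities
import Literature.Analysis.FunctionSpaces.MorreyConvexDomain
import Mathlib.Analysis.Calculus.FDeriv.Symmetric
import HarnessLib

/-!
# `W^{3,2} ⊂ C^{1,1/2}` on the period cell of the cylinder: Hölder and sup bounds for the
derivative of functions smooth on the cell

Topic `Literature/Analysis/FluidPDE`. Proved results (no named facts). The Sobolev imbedding
theorem, R. A. Adams, *Sobolev Spaces* (1975), Thm. 5.4 Part II Case C', imbedding (9):
"Suppose `mp > n > (m-1)p`. Then `W^{j+m,p}(Ω) → C^{j,λ}(Ω̄)`, `0 < λ ≤ m − (n/p)`" for `Ω`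
with the strong local Lipschitz property (p. 89 of the held text; proved as Lemma 5.17, p. 99,
whose `m = 1` step is Morrey's estimate on convex cells), in the case `n = 3`, `m = p = 2`,
`j = 1`, `λ = 1/2`, on the open period cell `cylinderCell L = {r < 1} × (0, L)` of the periodic
cylinder, for functions smooth on the cell (the slices of the smooth Euler classes of
`Ferrari1993*`, `KatoLai*`, `ChenHou*`), with the tree's sum-form norm
`eSobolevDomainNorm 3 2 (cylinderCell L) volume`:

* `cylinderCell_fderiv_holderHalf_sup` — there is `C = C(L)` with
  `‖Df(x) − Df(y)‖ ≤ C ‖f‖_{W^{3,2}(cell)} |x − y|^{1/2}` and `‖Df(x)‖ ≤ C ‖f‖_{W^{3,2}(cell)}` for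
  all `x, y` in the cell and every `f` smooth on the cell with finite norm.

Proof (Adams' route for Part II through Part I and Lemma 5.17): for `f` smooth on the cell the
infima in the norm are attained at the classical derivatives
(`MeyersSerrin.eSobolevDomainNorm_succ_eq`), operator norms are controlled by values on the basis
`Module.finBasis` (`exists_opNorm_le_mul_sum_basis`) and second derivatives are symmetric
(`ContDiffAt.isSymmSndFDerivAt`), whence `‖D²f‖_{L²(cell)}, ‖D³f‖_{L²(cell)} ≲ ‖f‖_{W^{3,2}}`
(`cylinderCell_eLpNorm_fderiv_le` and its iterates); the Sobolev inequality on the cell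
(`cylinderCell_eLpNorm_six_le_add`, Adams Thm. 5.4 Part I Case A) gives
`‖D²f‖_{L⁶(cell)} ≲ ‖f‖_{W^{3,2}}`; Morrey's two-point estimate on the convex cell
(`morrey_holder_of_convex`, `p = 6 > 3`, exponent `1 − 3/6 = 1/2`) gives the Hölder bound, and
the `C_B` bound of Part I Case C (`cylinderCell_enorm_le_eSobolevDomainNorm_two` applied to the
partial derivatives `∂ᵢ f ∈ W^{2,2}`) gives the sup bound. The cell contains the ball
`B((L/2) e_z, min(1, L/2))` and lies in `B((L/2) e_z, 2 + L)`.

## Mathlib / tree search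

No Hölder-class imbedding on domains in Mathlib or the tree (`lean search 'Morrey|holderHalf'`:
the tree's whole-space `morrey_holder`, the convex-set `morrey_holder_of_convex`, and the cell's
`L⁶` / `C_B` / `W^{1,∞}` inequalities of `PeriodicCylinderSobolevInequalities` only).

## References

* R. A. Adams, *Sobolev Spaces*, Academic Press (1975), Thm. 5.4 Parts I–II (p. 89), Lemma 5.17
  (p. 99). [Adams1975]
-/

noncomputable section

open MeasureTheory Set Function Filter Topology TopologicalSpace Metric Module
open scoped ContDiff NNReal ENNReal

namespace Literature.Analysis.FluidPDE

open Literature.Analysis.FunctionSpaces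

/-! ### Geometry of the cell: an inner and an outer ball -/

/-- The cell contains the ball of radius `min(1, L/2)` about the axis point at height `L/2`.
[folklore] -/
theorem ball_subset_cylinderCell (L : ℝ) :
    ball ((L / 2) • EuclideanSpace.single (2 : Fin 3) (1 : ℝ)) (min 1 (L / 2)) ⊆
      (cylinderCell L : Set (EuclideanSpace ℝ (Fin 3))) := by
  intro x hx
  rw [mem_ball_iff_norm] at hx
  set c : (EuclideanSpace ℝ (Fin 3)) := (L / 2) • EuclideanSpace.single (2 : Fin 3) (1 : ℝ) with hc
  have hc0 : c 0 = 0 := by simp [hc]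
  have hc1 : c 1 = 0 := by simp [hc]
  have hc2 : c 2 = L / 2 := by simp [hc]
  have hcoord : ∀ i, |(x - c) i| ≤ ‖x - c‖ := fun i => by
    simpa [Real.norm_eq_abs] using PiLp.norm_apply_le (p := 2) (x - c) i
  have hr : cylRadius x ≤ ‖x - c‖ := by
    rw [cylRadius, Real.sqrt_le_left (norm_nonneg _), EuclideanSpace.norm_eq,
      Real.sq_sqrt (Finset.sum_nonneg fun i _ => by positivity), Fin.sum_univ_three]
    simp only [PiLp.sub_apply, hc0, hc1, sub_zero, Real.norm_eq_abs, sq_abs]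
    nlinarith [sq_nonneg (x 2 - c 2)]
  rw [SetLike.mem_coe, mem_cylinderCell]
  refine ⟨hr.trans_lt (hx.trans_le (min_le_left _ _)), ?_, ?_⟩
  · have h := (abs_le.1 ((hcoord 2).trans (hx.le.trans (min_le_right _ _)))).1
    simp only [PiLp.sub_apply, hc2] at h
    have h' : |(x - c) 2| < L / 2 := (hcoord 2).trans_lt (hx.trans_le (min_le_right _ _))
    simp only [PiLp.sub_apply, hc2, abs_lt] at h'
    linarith [h'.1]
  · have h' : |(x - c) 2| < L / 2 := (hcoord 2).trans_lt (hx.trans_le (min_le_right _ _))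
    simp only [PiLp.sub_apply, hc2, abs_lt] at h'
    linarith [h'.2]

/-- The cell lies in the ball of radius `2 + 2L` about the axis point at height `L/2`.
[folklore] -/
theorem cylinderCell_subset_ball {L : ℝ} (hL : 0 < L) :
    (cylinderCell L : Set (EuclideanSpace ℝ (Fin 3))) ⊆
      ball ((L / 2) • EuclideanSpace.single (2 : Fin 3) (1 : ℝ)) (2 + 2 * L) := by
  intro x hx
  rw [mem_ball_iff_norm]
  have h1 : ‖x‖ ≤ Real.sqrt (1 + L ^ 2) := norm_le_of_mem_cylinderCell hx
  have h2 : ‖(L / 2) • EuclideanSpace.single (2 : Fin 3) (1 : ℝ)‖ = L / 2 := by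
    rw [norm_smul, EuclideanSpace.single, PiLp.norm_single, norm_one, mul_one,
      Real.norm_of_nonneg (by linarith)]
  have h3 : Real.sqrt (1 + L ^ 2) ≤ 1 + L := by
    rw [Real.sqrt_le_left (by linarith)]
    nlinarith
  calc ‖x - (L / 2) • EuclideanSpace.single (2 : Fin 3) (1 : ℝ)‖
      ≤ ‖x‖ + ‖(L / 2) • EuclideanSpace.single (2 : Fin 3) (1 : ℝ)‖ := norm_sub_le _ _
    _ ≤ (1 + L) + L / 2 := by rw [h2]; exact add_le_add (h1.trans h3) le_rfl
    _ < 2 + 2 * L := by linarith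

/-! ### Classical derivatives of smooth functions on the cell against the Sobolev norm -/

section Smooth

variable {F : Type*} [NormedAddCommGroup F] [NormedSpace ℝ F] [CompleteSpace F]

omit [CompleteSpace F] in
/-- The derivative of a partial derivative on an open set: for `g` smooth on the open `Ω` and
`x ∈ Ω`, `D(y ↦ Dg(y) v)(x) = (D(Dg)(x)).flip v`, i.e. `w ↦ D²g(x) w v`
(`fderiv_clm_apply`). [folklore] -/
theorem fderiv_fderiv_apply_eq_flip_of_isOpen {Ω : Set (EuclideanSpace ℝ (Fin 3))} (hΩ : IsOpen Ω)
    {g : (EuclideanSpace ℝ (Fin 3)) → F}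
    (hg : ContDiffOn ℝ ∞ g Ω) (v : (EuclideanSpace ℝ (Fin 3))) {x : (EuclideanSpace ℝ (Fin 3))} (hx
        : x ∈ Ω) :
    fderiv ℝ (fun y => fderiv ℝ g y v) x = (fderiv ℝ (fderiv ℝ g) x).flip v := by
  have hD : ContDiffOn ℝ ∞ (fderiv ℝ g) Ω := ((contDiffOn_infty_iff_fderiv_of_isOpen hΩ).1 hg).2
  have hd : DifferentiableAt ℝ (fderiv ℝ g) x :=
    ((hD.differentiableOn (by simp)) x hx).differentiableAt (hΩ.mem_nhds hx)
  rw [fderiv_clm_apply hd (differentiableAt_const v)]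
  simp

omit [CompleteSpace F] in
/-- **Symmetry of second derivatives on an open set**: for `g` smooth on the open `Ω` and
`x ∈ Ω`, `D(y ↦ Dg(y) v)(x) = D(Dg)(x) v` as continuous linear maps (Schwarz,
`ContDiffAt.isSymmSndFDerivAt`, combined with `fderiv_fderiv_apply_eq_flip_of_isOpen`).
[folklore] -/
theorem fderiv_fderiv_apply_eq_of_isOpen {Ω : Set (EuclideanSpace ℝ (Fin 3))} (hΩ : IsOpen Ω) {g :
    (EuclideanSpace ℝ (Fin 3)) → F}
    (hg : ContDiffOn ℝ ∞ g Ω) (v : (EuclideanSpace ℝ (Fin 3))) {x : (EuclideanSpace ℝ (Fin 3))} (hx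
        : x ∈ Ω) :
    fderiv ℝ (fun y => fderiv ℝ g y v) x = fderiv ℝ (fderiv ℝ g) x v := by
  rw [fderiv_fderiv_apply_eq_flip_of_isOpen hΩ hg v hx]
  have hsymm : IsSymmSndFDerivAt ℝ g x :=
    (hg.contDiffAt (hΩ.mem_nhds hx)).isSymmSndFDerivAt
      (by
        rw [minSmoothness_of_isRCLikeNormedField]
        have h2 : ((2 : ℕ∞) : WithTop ℕ∞) ≤ ((⊤ : ℕ∞) : WithTop ℕ∞) := WithTop.coe_le_coe.2 le_top
        simpa using h2)
  ext w
  rw [ContinuousLinearMap.flip_apply]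
  exact hsymm w v

variable (L : ℝ)

/-- **`‖Dg‖_{L²(cell)} ≲ ‖g‖_{W^{k+1,2}(cell)}`** for `g` smooth on the cell: the operator norm of
`Dg(x)` is bounded by its values on the basis `Module.finBasis` (`exists_opNorm_le_mul_sum_basis`,
`eLpNorm_le_mul_sum_eLpNorm_apply_basis`), and `Σᵢ ‖∂ᵢ g‖_{W^{k,2}} ≤ ‖g‖_{W^{k+1,2}}`
(`MeyersSerrin.eSobolevDomainNorm_succ_eq` at the classical derivative). [folklore] -/
theorem cylinderCell_eLpNorm_fderiv_le :
    ∃ C : ℝ≥0, ∀ (k : ℕ) (g : (EuclideanSpace ℝ (Fin 3)) → F), ContDiffOn ℝ ∞ g (cylinderCell L :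
        Set (EuclideanSpace ℝ (Fin 3))) →
      eLpNorm (fderiv ℝ g) 2 (volume.restrict (cylinderCell L : Set (EuclideanSpace ℝ (Fin 3)))) ≤
        C * eSobolevDomainNorm (k + 1) 2 (cylinderCell L) volume g := by
  obtain ⟨C, -, hC⟩ := exists_opNorm_le_mul_sum_basis (F := F) (finBasis ℝ (EuclideanSpace ℝ (Fin
      3)))
  refine ⟨C, fun k g hg => ?_⟩
  set Ω := cylinderCell L with hΩ
  set ν : Measure (EuclideanSpace ℝ (Fin 3)) := volume.restrict (Ω : Set (EuclideanSpace ℝ (Fin 3)))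
  have hW : HasWeakFDerivOn Ω volume g (fderiv ℝ g) := MeyersSerrin.hasWeakFDerivOn_of_contDiffOn hg
  have hmeas : AEStronglyMeasurable (fderiv ℝ g) ν :=
      hW.locallyIntegrableOn_deriv.aestronglyMeasurable
  calc eLpNorm (fderiv ℝ g) 2 ν
      ≤ C * ∑ i, eLpNorm (fun x => fderiv ℝ g x (finBasis ℝ (EuclideanSpace ℝ (Fin 3)) i)) 2 ν :=
        eLpNorm_le_mul_sum_eLpNorm_apply_basis (finBasis ℝ (EuclideanSpace ℝ (Fin 3))) hC hmeas (by
            norm_num)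
    _ ≤ C * ∑ i, eSobolevDomainNorm k 2 Ω volume (fun x => fderiv ℝ g x (finBasis ℝ (EuclideanSpace
        ℝ (Fin 3)) i)) := by
        gcongr with i
        exact eLpNorm_le_eSobolevDomainNorm
    _ ≤ C * eSobolevDomainNorm (k + 1) 2 Ω volume g := by
        rw [MeyersSerrin.eSobolevDomainNorm_succ_eq hW]
        gcongr
        exact le_add_self

/-- Partial derivatives of a function smooth on the cell are smooth on the cell, and their
`W^{k,2}` norms are bounded by the `W^{k+1,2}` norm of the function (one summand of
`MeyersSerrin.eSobolevDomainNorm_succ_eq`). [folklore] -/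
theorem cylinderCell_eSobolevDomainNorm_fderiv_apply_le (k : ℕ) {g : (EuclideanSpace ℝ (Fin 3)) → F}
    (hg : ContDiffOn ℝ ∞ g (cylinderCell L : Set (EuclideanSpace ℝ (Fin 3)))) (i : Fin (finrank ℝ
        (EuclideanSpace ℝ (Fin 3)))) :
    eSobolevDomainNorm k 2 (cylinderCell L) volume (fun x => fderiv ℝ g x (finBasis ℝ
        (EuclideanSpace ℝ (Fin 3)) i)) ≤
      eSobolevDomainNorm (k + 1) 2 (cylinderCell L) volume g := by
  rw [MeyersSerrin.eSobolevDomainNorm_succ_eq (MeyersSerrin.hasWeakFDerivOn_of_contDiffOn hg)]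
  refine le_trans ?_ le_add_self
  exact Finset.single_le_sum
    (f := fun j => eSobolevDomainNorm k 2 (cylinderCell L) volume
      (fun x => fderiv ℝ g x (finBasis ℝ (EuclideanSpace ℝ (Fin 3)) j))) (fun _ _ => zero_le)
          (Finset.mem_univ i)

/-- **`‖D²g‖_{L²(cell)} ≲ ‖g‖_{W^{k+2,2}(cell)}`** for `g` smooth on the cell: the operator norm of
`D²g(x)` is bounded by `Σᵢ ‖D²g(x) eᵢ‖ = Σᵢ ‖D(∂ᵢ g)(x)‖` (symmetry of second derivatives), and
`cylinderCell_eLpNorm_fderiv_le` applies to each `∂ᵢ g`. [folklore] -/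
theorem cylinderCell_eLpNorm_fderiv_fderiv_le :
    ∃ C : ℝ≥0, ∀ (k : ℕ) (g : (EuclideanSpace ℝ (Fin 3)) → F), ContDiffOn ℝ ∞ g (cylinderCell L :
        Set (EuclideanSpace ℝ (Fin 3))) →
      eLpNorm (fderiv ℝ (fderiv ℝ g)) 2 (volume.restrict (cylinderCell L : Set (EuclideanSpace ℝ
          (Fin 3)))) ≤
        C * eSobolevDomainNorm (k + 2) 2 (cylinderCell L) volume g := by
  obtain ⟨C₁, -, hC₁⟩ := exists_opNorm_le_mul_sum_basis (F := (EuclideanSpace ℝ (Fin 3)) →L[ℝ] F)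
      (finBasis ℝ (EuclideanSpace ℝ (Fin 3)))
  obtain ⟨C₂, hC₂⟩ := cylinderCell_eLpNorm_fderiv_le (F := F) L
  refine ⟨3 * C₁ * C₂, fun k g hg => ?_⟩
  set Ω := cylinderCell L with hΩ
  set ν : Measure (EuclideanSpace ℝ (Fin 3)) := volume.restrict (Ω : Set (EuclideanSpace ℝ (Fin
      3))) with hν
  have hD : ContDiffOn ℝ ∞ (fderiv ℝ g) (Ω : Set (EuclideanSpace ℝ (Fin 3))) :=
    ((contDiffOn_infty_iff_fderiv_of_isOpen Ω.isOpen).1 hg).2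
  have hDi : ∀ i, ContDiffOn ℝ ∞ (fun x => fderiv ℝ g x (finBasis ℝ (EuclideanSpace ℝ (Fin 3)) i))
      (Ω : Set (EuclideanSpace ℝ (Fin 3))) :=
    fun i => hD.clm_apply contDiffOn_const
  have hmeas : AEStronglyMeasurable (fderiv ℝ (fderiv ℝ g)) ν :=
    (MeyersSerrin.hasWeakFDerivOn_of_contDiffOn (μ := volume) hD).locallyIntegrableOn_deriv
      |>.aestronglyMeasurable
  -- `x ↦ D²g(x) eᵢ` is the derivative of `∂ᵢ g` on the cell
  have hcongr : ∀ i, eLpNorm (fun x => fderiv ℝ (fderiv ℝ g) x (finBasis ℝ (EuclideanSpace ℝ (Fin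
      3)) i)) 2 ν =
      eLpNorm (fderiv ℝ (fun y => fderiv ℝ g y (finBasis ℝ (EuclideanSpace ℝ (Fin 3)) i))) 2 ν :=
          fun i => by
    refine eLpNorm_congr_ae ?_
    rw [hν, Filter.EventuallyEq, ae_restrict_iff' Ω.isOpen.measurableSet]
    exact Eventually.of_forall fun x hx =>
      (fderiv_fderiv_apply_eq_of_isOpen Ω.isOpen hg (finBasis ℝ (EuclideanSpace ℝ (Fin 3)) i)
          hx).symm
  calc eLpNorm (fderiv ℝ (fderiv ℝ g)) 2 ν
      ≤ C₁ * ∑ i, eLpNorm (fun x => fderiv ℝ (fderiv ℝ g) x (finBasis ℝ (EuclideanSpace ℝ (Fin 3))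
          i)) 2 ν :=
        eLpNorm_le_mul_sum_eLpNorm_apply_basis (finBasis ℝ (EuclideanSpace ℝ (Fin 3))) hC₁ hmeas
            (by norm_num)
    _ = C₁ * ∑ i, eLpNorm (fderiv ℝ (fun y => fderiv ℝ g y (finBasis ℝ (EuclideanSpace ℝ (Fin 3))
        i))) 2 ν := by
        congr 1
        exact Finset.sum_congr rfl fun i _ => hcongr i
    _ ≤ C₁ * ∑ i, C₂ * eSobolevDomainNorm (k + 1) 2 Ω volume
          (fun y => fderiv ℝ g y (finBasis ℝ (EuclideanSpace ℝ (Fin 3)) i)) := by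
        gcongr with i
        exact hC₂ k _ (hDi i)
    _ ≤ C₁ * ∑ _i : Fin (finrank ℝ (EuclideanSpace ℝ (Fin 3))), C₂ * eSobolevDomainNorm (k + 2) 2 Ω
        volume g := by
        gcongr with i
        exact cylinderCell_eSobolevDomainNorm_fderiv_apply_le L (k + 1) hg i
    _ = ((3 * C₁ * C₂ : ℝ≥0) : ℝ≥0∞) * eSobolevDomainNorm (k + 2) 2 Ω volume g := by
        rw [Finset.sum_const, Finset.card_univ, Fintype.card_fin, finrank_euclideanSpace_fin]
        push_cast
        ring

/-- From an extended-norm bound `‖a‖ₑ ≤ ENNReal.ofReal r`, `r ≥ 0`, to the real bound `‖a‖ ≤ r`.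
[folklore] -/
theorem norm_le_of_enorm_le_ofReal {G : Type*} [NormedAddCommGroup G] {a : G} {r : ℝ} (hr : 0 ≤ r)
    (h : ‖a‖ₑ ≤ ENNReal.ofReal r) : ‖a‖ ≤ r := by
  rw [← ofReal_norm] at h
  exact (ENNReal.ofReal_le_ofReal_iff hr).1 h

/-- **`W^{3,2}(cell) ⊂ C_B^1(cell)`, pointwise** (Adams, *Sobolev Spaces* (1975), Thm. 5.4 Part I
Case C, imbedding (8) with `j = 1`, `m = p = 2`, `n = 3`, as in Remark 5.5 (5)): there is
`C = C(L)` with `‖Df(x)‖ ≤ C n` for all `x` in the cell, for every `f` smooth on the open cell with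
`‖f‖_{W^{3,2}(cell)} ≤ n`: `‖∂ᵢ f(x)‖ ≤ K ‖∂ᵢ f‖_{W^{2,2}} ≤ K n`
(`cylinderCell_enorm_le_eSobolevDomainNorm_two`) and `‖Df(x)‖ ≤ C_b Σᵢ ‖∂ᵢ f(x)‖`.
[cite: Adams1975, Thm. 5.4 Part I Case C (8) (p. 89) and Remark 5.5 (5) (p. 90)] -/
theorem cylinderCell_norm_fderiv_le [FiniteDimensional ℝ F] (L : ℝ) :
    ∃ C : ℝ≥0, ∀ (f : (EuclideanSpace ℝ (Fin 3)) → F), ContDiffOn ℝ ∞ f (cylinderCell L : Set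
        (EuclideanSpace ℝ (Fin 3))) →
      ∀ n : ℝ≥0, eSobolevDomainNorm 3 2 (cylinderCell L) volume f ≤ n →
      ∀ x ∈ (cylinderCell L : Set (EuclideanSpace ℝ (Fin 3))), ‖fderiv ℝ f x‖ ≤ C * n := by
  set Ω := cylinderCell L with hΩ
  obtain ⟨K, hK⟩ := cylinderCell_enorm_le_eSobolevDomainNorm_two (F := F) L
  obtain ⟨Cb, -, hCb⟩ := exists_opNorm_le_mul_sum_basis (F := F) (finBasis ℝ (EuclideanSpace ℝ (Fin
      3)))
  refine ⟨Cb * (3 * K), fun f hf n hn x hx => ?_⟩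
  have hNtop : eSobolevDomainNorm 3 2 Ω volume f < ⊤ := hn.trans_lt ENNReal.coe_lt_top
  have hD : ContDiffOn ℝ ∞ (fderiv ℝ f) (Ω : Set (EuclideanSpace ℝ (Fin 3))) :=
    ((contDiffOn_infty_iff_fderiv_of_isOpen Ω.isOpen).1 hf).2
  have hi : ∀ i, ‖fderiv ℝ f x (finBasis ℝ (EuclideanSpace ℝ (Fin 3)) i)‖ ≤ (K : ℝ) * n := by
    intro i
    have hPi : ContDiffOn ℝ ∞ (fun y => fderiv ℝ f y (finBasis ℝ (EuclideanSpace ℝ (Fin 3)) i)) (Ω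
        : Set (EuclideanSpace ℝ (Fin 3))) :=
      hD.clm_apply contDiffOn_const
    have hPnorm : eSobolevDomainNorm 2 2 Ω volume (fun y => fderiv ℝ f y (finBasis ℝ
        (EuclideanSpace ℝ (Fin 3)) i)) ≤
        eSobolevDomainNorm 3 2 Ω volume f :=
      cylinderCell_eSobolevDomainNorm_fderiv_apply_le L 2 hf i
    have hmem : MemSobolevDomain 2 2 Ω volume (fun y => fderiv ℝ f y (finBasis ℝ (EuclideanSpace ℝ
        (Fin 3)) i)) :=
      memSobolevDomain_cylinderCell_of_lt_top hPi.continuousOn (hPnorm.trans_lt hNtop)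
    have h := hK _ hmem hPi.continuousOn x hx
    have hKn : (K : ℝ≥0∞) * eSobolevDomainNorm 2 2 Ω volume
        (fun y => fderiv ℝ f y (finBasis ℝ (EuclideanSpace ℝ (Fin 3)) i)) ≤ ENNReal.ofReal ((K : ℝ)
            * n) := by
      rw [ENNReal.ofReal_mul K.coe_nonneg, ENNReal.ofReal_coe_nnreal, ENNReal.ofReal_coe_nnreal]
      exact mul_le_mul' le_rfl (hPnorm.trans hn)
    exact norm_le_of_enorm_le_ofReal (by positivity) (h.trans hKn)
  calc ‖fderiv ℝ f x‖ ≤ Cb * ∑ i, ‖fderiv ℝ f x (finBasis ℝ (EuclideanSpace ℝ (Fin 3)) i)‖ := hCb _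
    _ ≤ Cb * ∑ _i : Fin (finrank ℝ (EuclideanSpace ℝ (Fin 3))), (K : ℝ) * n :=
        mul_le_mul_of_nonneg_left (Finset.sum_le_sum fun i _ => hi i) Cb.coe_nonneg
    _ = ((Cb * (3 * K) : ℝ≥0) : ℝ) * n := by
        rw [Finset.sum_const, Finset.card_univ, Fintype.card_fin, finrank_euclideanSpace_fin]
        push_cast
        ring

/-- **`W^{3,2}(cell) ⊂ C^{1,1/2}(cell)`, Hölder part** (Adams, *Sobolev Spaces* (1975), Thm. 5.4
Part II Case C', imbedding (9), `n = 3`, `m = p = 2`, `j = 1`, `λ = 1/2`; Lemma 5.17): there is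
`C = C(L)` such that every `f` smooth on the open period cell with `‖f‖_{W^{3,2}(cell)} ≤ n`
satisfies `‖Df(x) − Df(y)‖ ≤ C n |x − y|^{1/2}` for all `x, y` in the cell:
`‖D²f‖_{L⁶(cell)} ≲ Σᵢ ‖D(∂ᵢf)‖_{L⁶(cell)}` (values on the basis, symmetry of second derivatives),
`‖D(∂ᵢf)‖_{L⁶} ≤ C_G (‖D(∂ᵢf)‖_{L²} + ‖D²(∂ᵢf)‖_{L²}) ≲ n` (`cylinderCell_eLpNorm_six_le_add`, the
Sobolev inequality on the cell) and Morrey's two-point estimate on the convex cell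
(`morrey_holder_of_convex`, `p = 6`, between the balls `B((L/2)e_z, min(1, L/2))` and
`B((L/2)e_z, 2 + 2L)`). [cite: Adams1975, Thm. 5.4 Part II Case C' (9) (p. 89) and Lemma 5.17 (p.
99)] -/
theorem cylinderCell_fderiv_holderHalf {L : ℝ} (hL : 0 < L) :
    ∃ C : ℝ≥0, ∀ (f : (EuclideanSpace ℝ (Fin 3)) → F), ContDiffOn ℝ ∞ f (cylinderCell L : Set
        (EuclideanSpace ℝ (Fin 3))) →
      ∀ n : ℝ≥0, eSobolevDomainNorm 3 2 (cylinderCell L) volume f ≤ n →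
      ∀ x ∈ (cylinderCell L : Set (EuclideanSpace ℝ (Fin 3))), ∀ y ∈ (cylinderCell L : Set
          (EuclideanSpace ℝ (Fin 3))),
        ‖fderiv ℝ f x - fderiv ℝ f y‖ ≤ C * n * ‖x - y‖ ^ (1 / 2 : ℝ) := by
  set Ω := cylinderCell L with hΩ
  -- the constants
  obtain ⟨C₁, hC₁⟩ := cylinderCell_eLpNorm_fderiv_le (F := F) L
  obtain ⟨C₂, hC₂⟩ := cylinderCell_eLpNorm_fderiv_fderiv_le (F := F) L
  obtain ⟨C_G, hG⟩ := cylinderCell_eLpNorm_six_le_add (F := (EuclideanSpace ℝ (Fin 3)) →L[ℝ] F) L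
  obtain ⟨Cb₂, -, hCb₂⟩ := exists_opNorm_le_mul_sum_basis (F := (EuclideanSpace ℝ (Fin 3)) →L[ℝ] F)
      (finBasis ℝ (EuclideanSpace ℝ (Fin 3)))
  have hR₀ : 0 < min 1 (L / 2) := lt_min one_pos (by linarith)
  obtain ⟨C_M, hC_Mtop, hM⟩ := morrey_holder_of_convex (volume : Measure (EuclideanSpace ℝ (Fin 3)))
    (F := (EuclideanSpace ℝ (Fin 3)) →L[ℝ] F) (p := 6) (by norm_num)
    (by rw [finrank_euclideanSpace_fin]; norm_num)
    Ω.isOpen (convex_cylinderCell L) hR₀ (ball_subset_cylinderCell L) (cylinderCell_subset_ball hL)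
  set C_H : ℝ≥0 := C_M.toNNReal * (3 * Cb₂ * C_G * (C₁ + C₂)) with hC_H
  refine ⟨C_H, fun f hf n hn x hx y hy => ?_⟩
  set ν : Measure (EuclideanSpace ℝ (Fin 3)) := volume.restrict (Ω : Set (EuclideanSpace ℝ (Fin
      3))) with hν
  set N := eSobolevDomainNorm 3 2 Ω volume f with hN
  have hNn : N ≤ n := hn
  have hNtop : N < ⊤ := hNn.trans_lt ENNReal.coe_lt_top
  have hCNtop : ∀ C : ℝ≥0, (C : ℝ≥0∞) * N < ⊤ := fun C => ENNReal.mul_lt_top ENNReal.coe_lt_top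
      hNtop
  -- derivatives of `f` and of its partial derivatives on the cell
  have hD : ContDiffOn ℝ ∞ (fderiv ℝ f) (Ω : Set (EuclideanSpace ℝ (Fin 3))) :=
    ((contDiffOn_infty_iff_fderiv_of_isOpen Ω.isOpen).1 hf).2
  have hDD : ContDiffOn ℝ ∞ (fderiv ℝ (fderiv ℝ f)) (Ω : Set (EuclideanSpace ℝ (Fin 3))) :=
    ((contDiffOn_infty_iff_fderiv_of_isOpen Ω.isOpen).1 hD).2
  have hmeas2 : AEStronglyMeasurable (fderiv ℝ (fderiv ℝ f)) ν :=
    (MeyersSerrin.hasWeakFDerivOn_of_contDiffOn (μ := volume) hD).locallyIntegrableOn_deriv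
      |>.aestronglyMeasurable
  have hPi : ∀ i, ContDiffOn ℝ ∞ (fun y => fderiv ℝ f y (finBasis ℝ (EuclideanSpace ℝ (Fin 3)) i))
      (Ω : Set (EuclideanSpace ℝ (Fin 3))) :=
    fun i => hD.clm_apply contDiffOn_const
  have hDPi : ∀ i, ContDiffOn ℝ ∞ (fderiv ℝ (fun y => fderiv ℝ f y (finBasis ℝ (EuclideanSpace ℝ
      (Fin 3)) i))) (Ω : Set (EuclideanSpace ℝ (Fin 3))) :=
    fun i => ((contDiffOn_infty_iff_fderiv_of_isOpen Ω.isOpen).1 (hPi i)).2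
  have hPnorm : ∀ i, eSobolevDomainNorm 2 2 Ω volume (fun y => fderiv ℝ f y (finBasis ℝ
      (EuclideanSpace ℝ (Fin 3)) i)) ≤ N :=
    fun i => cylinderCell_eSobolevDomainNorm_fderiv_apply_le L 2 hf i
  have hDP2 : ∀ i, eLpNorm (fderiv ℝ (fun y => fderiv ℝ f y (finBasis ℝ (EuclideanSpace ℝ (Fin 3))
      i))) 2 ν ≤ C₁ * N :=
    fun i => (hC₁ 1 _ (hPi i)).trans (mul_le_mul' le_rfl (hPnorm i))
  have hDDP2 : ∀ i,
      eLpNorm (fderiv ℝ (fderiv ℝ (fun y => fderiv ℝ f y (finBasis ℝ (EuclideanSpace ℝ (Fin 3))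
          i)))) 2 ν ≤ C₂ * N :=
    fun i => (hC₂ 0 _ (hPi i)).trans (mul_le_mul' le_rfl (hPnorm i))
  -- `D(∂ᵢ f) ∈ W^{1,2}(cell)` with weak derivative `D²(∂ᵢ f)`
  have hWi : ∀ i, HasWeakFDerivOn Ω volume (fderiv ℝ (fun y => fderiv ℝ f y (finBasis ℝ
      (EuclideanSpace ℝ (Fin 3)) i)))
      (fderiv ℝ (fderiv ℝ (fun y => fderiv ℝ f y (finBasis ℝ (EuclideanSpace ℝ (Fin 3)) i)))) :=
    fun i => MeyersSerrin.hasWeakFDerivOn_of_contDiffOn (hDPi i)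
  have hmemi : ∀ i, MemSobolevDomain 1 2 Ω volume
      (fderiv ℝ (fun y => fderiv ℝ f y (finBasis ℝ (EuclideanSpace ℝ (Fin 3)) i))) := by
    intro i
    have hm1 : AEStronglyMeasurable (fderiv ℝ (fun y => fderiv ℝ f y (finBasis ℝ (EuclideanSpace ℝ
        (Fin 3)) i))) ν :=
      (hWi i).locallyIntegrableOn.aestronglyMeasurable
    have hm2 : AEStronglyMeasurable
        (fderiv ℝ (fderiv ℝ (fun y => fderiv ℝ f y (finBasis ℝ (EuclideanSpace ℝ (Fin 3)) i)))) ν :=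
      (hWi i).locallyIntegrableOn_deriv.aestronglyMeasurable
    refine ⟨⟨hm1, (hDP2 i).trans_lt (hCNtop C₁)⟩, _, hWi i, fun u => ?_⟩
    rw [memSobolevDomain_zero_iff]
    refine ⟨(ContinuousLinearMap.apply ℝ ((EuclideanSpace ℝ (Fin 3)) →L[ℝ] F)
        u).continuous.comp_aestronglyMeasurable hm2,
      ?_⟩
    refine lt_of_le_of_lt (eLpNorm_le_nnreal_smul_eLpNorm_of_ae_le_mul (c := ‖u‖₊)
      (g := fderiv ℝ (fderiv ℝ (fun y => fderiv ℝ f y (finBasis ℝ (EuclideanSpace ℝ (Fin 3)) i))))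
      (Eventually.of_forall fun x => ?_) 2) ?_
    · rw [mul_comm]
      exact ContinuousLinearMap.le_opNNNorm _ _
    · rw [ENNReal.smul_def, smul_eq_mul]
      exact ENNReal.mul_lt_top ENNReal.coe_lt_top ((hDDP2 i).trans_lt (hCNtop C₂))
  -- `L⁶` bound of `D²f` through the `D(∂ᵢ f)`
  have hcongr : ∀ i, eLpNorm (fun x => fderiv ℝ (fderiv ℝ f) x (finBasis ℝ (EuclideanSpace ℝ (Fin
      3)) i)) 6 ν =
      eLpNorm (fderiv ℝ (fun y => fderiv ℝ f y (finBasis ℝ (EuclideanSpace ℝ (Fin 3)) i))) 6 ν :=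
          fun i => by
    refine eLpNorm_congr_ae ?_
    rw [hν, Filter.EventuallyEq, ae_restrict_iff' Ω.isOpen.measurableSet]
    exact Eventually.of_forall fun x hx =>
      (fderiv_fderiv_apply_eq_of_isOpen Ω.isOpen hf (finBasis ℝ (EuclideanSpace ℝ (Fin 3)) i)
          hx).symm
  have h6 : eLpNorm (fderiv ℝ (fderiv ℝ f)) 6 ν ≤ (3 * Cb₂ * C_G * (C₁ + C₂) : ℝ≥0) * N := by
    calc eLpNorm (fderiv ℝ (fderiv ℝ f)) 6 ν
        ≤ Cb₂ * ∑ i, eLpNorm (fun x => fderiv ℝ (fderiv ℝ f) x (finBasis ℝ (EuclideanSpace ℝ (Fin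
            3)) i)) 6 ν :=
          eLpNorm_le_mul_sum_eLpNorm_apply_basis (finBasis ℝ (EuclideanSpace ℝ (Fin 3))) hCb₂
              hmeas2 (by norm_num)
      _ = Cb₂ * ∑ i, eLpNorm (fderiv ℝ (fun y => fderiv ℝ f y (finBasis ℝ (EuclideanSpace ℝ (Fin
          3)) i))) 6 ν := by
          congr 1; exact Finset.sum_congr rfl fun i _ => hcongr i
      _ ≤ Cb₂ * ∑ i, (C_G * (eLpNorm (fderiv ℝ (fun y => fderiv ℝ f y (finBasis ℝ (EuclideanSpace ℝ
          (Fin 3)) i))) 2 ν +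
            eLpNorm (fderiv ℝ (fderiv ℝ (fun y => fderiv ℝ f y (finBasis ℝ (EuclideanSpace ℝ (Fin
                3)) i)))) 2 ν)) := by
          gcongr with i
          exact hG _ _ (hmemi i) (hWi i)
      _ ≤ Cb₂ * ∑ _i : Fin (finrank ℝ (EuclideanSpace ℝ (Fin 3))), (C_G * (C₁ * N + C₂ * N)) := by
          gcongr with i
          · exact hDP2 i
          · exact hDDP2 i
      _ = (3 * Cb₂ * C_G * (C₁ + C₂) : ℝ≥0) * N := by
          rw [Finset.sum_const, Finset.card_univ, Fintype.card_fin, finrank_euclideanSpace_fin]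
          push_cast
          ring
  -- Morrey's two-point estimate
  have key := hM (hD.of_le (by exact_mod_cast le_top)) hx hy
  have hexp : (1 - (finrank ℝ (EuclideanSpace ℝ (Fin 3)) : ℝ) / (6 : ℝ≥0)) = (1 / 2 : ℝ) := by
    rw [finrank_euclideanSpace_fin]; norm_num
  rw [hexp] at key
  have hCM : C_M = (C_M.toNNReal : ℝ≥0∞) := (ENNReal.coe_toNNReal hC_Mtop.ne).symm
  have hrhs : C_M * eLpNorm (fderiv ℝ (fderiv ℝ f)) 6 ν * edist x y ^ (1 / 2 : ℝ) ≤
      ENNReal.ofReal ((C_H : ℝ) * n * ‖x - y‖ ^ (1 / 2 : ℝ)) := by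
    rw [edist_dist, dist_eq_norm, ENNReal.ofReal_rpow_of_nonneg (norm_nonneg _) (by norm_num),
      hCM, ENNReal.ofReal_mul (by positivity), ENNReal.ofReal_mul (by positivity),
      ENNReal.ofReal_coe_nnreal, ENNReal.ofReal_coe_nnreal]
    calc (C_M.toNNReal : ℝ≥0∞) * eLpNorm (fderiv ℝ (fderiv ℝ f)) 6 ν *
          ENNReal.ofReal (‖x - y‖ ^ (1 / 2 : ℝ))
        ≤ (C_M.toNNReal : ℝ≥0∞) * ((3 * Cb₂ * C_G * (C₁ + C₂) : ℝ≥0) * n) *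
            ENNReal.ofReal (‖x - y‖ ^ (1 / 2 : ℝ)) :=
          mul_le_mul' (mul_le_mul' le_rfl (h6.trans (mul_le_mul' le_rfl hNn))) le_rfl
      _ = (C_H : ℝ≥0∞) * n * ENNReal.ofReal (‖x - y‖ ^ (1 / 2 : ℝ)) := by
          rw [hC_H]
          push_cast
          ring
  exact norm_le_of_enorm_le_ofReal (by positivity) (key.trans hrhs)

end Smooth

end Literature.Analysis.FluidPDE
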